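import Literature.Probability.LatticeModels.CollarLegModelStrandsConsistency
import Literature.Probability.LatticeModels.CollarLegModelStrandsExpansion
import Summits.CriticalPhenomena.CardyFormulaZ2.Theorems.CardyBoundaryCoulombGasBoundaryDefectGaussianRStubRealisabilityPart5

/-!
# Stub `stub_realisability` of line `rainbow-monomials-in-excursion-kernels` — Part 14:
# the per-configuration rewrite of the product of turn factors as a strand-expansion summand
# (crux `BoundaryDefectGaussianR`, stmt-CriticalPhenomena-14132; insertion dictionary D2, layer 2)

For a GENERAL `Literature.Probability.LatticeModels.CollarLegModel` `M`, a height configuration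
`h : M.freeCells → ℤ` with unit height differences across every tracked corner (every vertex-cell
`x` and face-cell `f` at `x`: `|hv h x - hf h f| = 1`), and ANY completed bond configuration `β`
(in the application `β = M.cfgOf ω`, `ω ⊆ M.E`), the product over a set `s` of corners of the turn
factors of the strand representation (`CollarLegModelStrands*`:
`weight h = Σ_{ω ⊆ E} ∏_{c ∈ cornerSet (piece M)} turnFactor h (cfgOf ω) c`) is rewritten in the
summand shape of the abstract Baxter–Kelland–Wu strand expansion of Part 5
(`s12_bkwStrandExpansion` / `bkwStrand_sum_consistent_forced`:
`∑_{s consistent off B} ∏_c exp(i ε(s c) g c) = ∏_{uncut loops} 2cos(Σ g) · ∏_{strands} e^{iεΣg}`):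

* the CUT SET is `B = {c ∈ s | ¬ TargetsLive c ∧ ¬ TurnConsistent h β c}` — the corners arriving at
  a FROZEN medial vertex through an inconsistent or untracked turn (factor `1`, a defect);
* `perCfg_prod_turnFactor_eq` — **the per-configuration factor**:
  `∏_{c ∈ s} turnFactor h β c = 𝟙[∀ c ∈ s, c ∉ B → bit h (nextCorner β c) = bit h c] ·
     ∏_{c ∈ s} exp(i · ε(bit h c) · g c)`, with the arrow bit `bit h c = [h x - h f = 1]`,
  `ε = BKW.sgn`, and `g c = (π/12) · turnSign β c` off `B` (`turnSign = -1` along an open edge, a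
  right turn; `+1` across a closed one, a left turn) and `g c = 0` on `B`.

Ingredients (all landed in `CollarLegModelStrandsConsistency`): `prod_turnFactor_eq` (the product
is the indicator that every live turn is consistent times the phases of the consistent turns),
`turnConsistent_iff_bit_eq` (a tracked turn with unit differences is consistent iff its two arrow
bits agree) and `turnPhase_eq_exp`; plus the small geometric fact proved here that a corner with a
LIVE target, and its successor, are automatically tracked (both endpoints of a live edge lie in
`V`, and every face at a vertex of `V` is a face-cell), so that at live medial vertices
consistency is exactly `σ`-invariance of the arrow bits, while at frozen ones an inconsistent turn
is a cut. With Lemma V (unit differences at every tracked corner of the jump collar of an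
admissible datum) and Lemma C (its cut set does not depend on `h`, `ω`) — sibling Parts — the sum
over valid `h` of the right-hand side becomes, after the change of variables `s = bit h`
(injective by Part 10), the left side of `s12_bkwStrandExpansion`: layer 2 of D2. No hypothesis
`ω ⊆ M.E` is needed here (the statement holds for every `β`). Registered sub-goal carried here:
`s13_perConfigurationFactor` (`s = cornerSet (piece M)`, `β = cfgOf ω`).
-/

namespace Summit.CriticalPhenomena.CardyFormulaZ2.Cruxes.BoundaryDefectGaussianR.RainbowMonomialsInExcursionKernels

open Finset Literature.Probability.LatticeModels Literature.Probability.LatticeModels.CollarLegModel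
open Literature.Probability.Percolation

section PerConfigurationFactor

variable (M : CollarLegModel)

/-! ### Corners with a live target are tracked -/

/-- The face of a corner is a face at its vertex, in `ℤ × ℤ` coordinates. [folklore] -/
theorem perCfg_ofSite_cFace_mem_vertexFaces (c : Site 2 × Fin 4) :
    ofSite (cFace c) ∈ SixVertex.vertexFaces (ofSite c.1) := by
  obtain ⟨x, k⟩ := c
  fin_cases k <;> simp [cFace, faceAt, cornerOff, ofSite, SixVertex.vertexFaces]

/-- A corner at a vertex of `V` is tracked: its vertex is a vertex-cell and its face has a corner
in `V`. [folklore] -/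
theorem perCfg_isTracked_of_mem_V {c : Site 2 × Fin 4} (hc : ofSite c.1 ∈ M.V) : M.IsTracked c := by
  refine ⟨M.mem_vertexCells_of_mem hc, ?_⟩
  rw [faceCells, SixVertex.faces, mem_biUnion]
  exact ⟨ofSite c.1, hc, perCfg_ofSite_cFace_mem_vertexFaces c⟩

/-- A corner whose target edge is live sits at a vertex of `V`, and so does the far endpoint of
its target edge. [folklore] -/
theorem perCfg_mem_V_of_targetsLive {c : Site 2 × Fin 4} (hl : M.TargetsLive c) :
    ofSite c.1 ∈ M.V ∧ ofSite (c.1 + cornerUnit (c.2 + 1)) ∈ M.V := by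
  rw [TargetsLive, mem_image] at hl
  obtain ⟨e, he, hce⟩ := hl
  rw [E, inducedEdges, mem_filter] at he
  rw [edgeSym2, cTgt, Sym2.eq_iff] at hce
  rcases hce with ⟨h1, h2⟩ | ⟨h1, h2⟩
  · rw [← h2, ← h1, ofSite_toSite, ofSite_toSite]; exact he.2
  · rw [← h1, ← h2, ofSite_toSite, ofSite_toSite]; exact ⟨he.2.2, he.2.1⟩

/-- **A corner with a live target and its successor (in any configuration) are tracked.** [folklore] -/
theorem perCfg_isTracked_of_targetsLive (β : BondConfig (Site 2)) {c : Site 2 × Fin 4}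
    (hl : M.TargetsLive c) : M.IsTracked c ∧ M.IsTracked (nextCorner β c) := by
  obtain ⟨h1, h2⟩ := perCfg_mem_V_of_targetsLive M hl
  refine ⟨perCfg_isTracked_of_mem_V M h1, ?_⟩
  by_cases hb : cTgt c ∈ β
  · rw [nextCorner_of_mem hb]; exact perCfg_isTracked_of_mem_V M h2
  · rw [nextCorner_of_not_mem hb]; exact perCfg_isTracked_of_mem_V M h1

/-! ### Unit differences, bits and phases at tracked corners -/

variable {M} in
/-- Unit differences across every (vertex-cell, face-cell) corner give unit differences at every
tracked corner. [folklore] -/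
theorem perCfg_abs_sub_eq_one_of_isTracked {h : ↥M.freeCells → ℤ}
    (hunit : ∀ x ∈ M.vertexCells, ∀ f ∈ SixVertex.vertexFaces x, f ∈ M.faceCells → |M.hv h x - M.hf h f| = 1)
    {c : Site 2 × Fin 4} (ht : M.IsTracked c) : |M.hv h (ofSite c.1) - M.hf h (ofSite (cFace c))| = 1 :=
  hunit _ ht.1 _ (perCfg_ofSite_cFace_mem_vertexFaces c) ht.2

variable {M} in
/-- **A consistent turn has equal arrow bits** (unit differences at tracked corners assumed; the
two corners of a consistent turn are tracked by definition). [cite: BaxterKellandWu1976, §4] -/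
theorem perCfg_bit_eq_of_turnConsistent {h : ↥M.freeCells → ℤ}
    (hunit : ∀ x ∈ M.vertexCells, ∀ f ∈ SixVertex.vertexFaces x, f ∈ M.faceCells → |M.hv h x - M.hf h f| = 1)
    {β : BondConfig (Site 2)} {c : Site 2 × Fin 4} (hc : M.TurnConsistent h β c) :
    M.bit h (nextCorner β c) = M.bit h c :=
  (M.turnConsistent_iff_bit_eq h β c hc.1 hc.2.1 (perCfg_abs_sub_eq_one_of_isTracked hunit hc.1)
    (perCfg_abs_sub_eq_one_of_isTracked hunit hc.2.1)).1 hc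

variable {M} in
/-- **At a live medial vertex consistency is equality of the arrow bits** (both corners are
tracked automatically). [cite: BaxterKellandWu1976, §4] -/
theorem perCfg_turnConsistent_iff_of_targetsLive {h : ↥M.freeCells → ℤ}
    (hunit : ∀ x ∈ M.vertexCells, ∀ f ∈ SixVertex.vertexFaces x, f ∈ M.faceCells → |M.hv h x - M.hf h f| = 1)
    (β : BondConfig (Site 2)) {c : Site 2 × Fin 4} (hl : M.TargetsLive c) :
    M.TurnConsistent h β c ↔ M.bit h (nextCorner β c) = M.bit h c := by
  obtain ⟨ht, ht'⟩ := perCfg_isTracked_of_targetsLive M β hl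
  exact M.turnConsistent_iff_bit_eq h β c ht ht' (perCfg_abs_sub_eq_one_of_isTracked hunit ht)
    (perCfg_abs_sub_eq_one_of_isTracked hunit ht')

/-- **The turn phase of a corner with unit height difference**, written with the arrow sign
`BKW.sgn (bit h c)` and the turn sign `turnSign β c` (`-1` open / right, `+1` closed / left):
`turnPhase = exp(i · ε(bit) · (π/12) · turnSign)`. [cite: BaxterKellandWu1976, §4] -/
theorem perCfg_turnPhase_eq_exp (h : ↥M.freeCells → ℤ) (β : BondConfig (Site 2))
    (c : Site 2 × Fin 4) (hu : |M.hv h (ofSite c.1) - M.hf h (ofSite (cFace c))| = 1) :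
    M.turnPhase h β c =
      Complex.exp (Complex.I * (BKW.sgn (M.bit h c) : ℂ) * ((Real.pi / 12 * (turnSign β c : ℝ) : ℝ) : ℂ)) := by
  classical
  rw [M.turnPhase_eq_exp h β c hu]
  congr 1
  simp only [BKW.sgn, bit, turnSign, decide_eq_true_eq]
  split_ifs <;> push_cast <;> ring

/-! ### The per-configuration factor -/

variable {M} in
/-- **The per-configuration rewrite (general set of corners, general configuration).** For a
height configuration with unit differences at every tracked corner and any completed bond
configuration `β`, the product over `s` of the turn factors is the indicator that the arrow bits
are `nextCorner β`-invariant at every corner of `s` off the cut set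
`B = {c ∈ s | ¬ TargetsLive c ∧ ¬ TurnConsistent h β c}`, times `∏_{c ∈ s} exp(i ε(bit h c) g c)`
with `g = (π/12) · turnSign β` off `B` and `g = 0` on `B` — the summand of the abstract strand
expansion `s12_bkwStrandExpansion`. [cite: BaxterKellandWu1976, §3–§4] -/
theorem perCfg_prod_turnFactor_eq (h : ↥M.freeCells → ℤ) (β : BondConfig (Site 2))
    (s : Finset (Site 2 × Fin 4)) [DecidablePred fun c => M.TurnConsistent h β c]
    (hunit : ∀ x ∈ M.vertexCells, ∀ f ∈ SixVertex.vertexFaces x, f ∈ M.faceCells → |M.hv h x - M.hf h f| = 1) :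
    ∏ c ∈ s, M.turnFactor h β c =
      (if ∀ c ∈ s, c ∉ s.filter (fun c => ¬ M.TargetsLive c ∧ ¬ M.TurnConsistent h β c) →
          M.bit h (nextCorner β c) = M.bit h c then 1 else 0) *
        ∏ c ∈ s, Complex.exp (Complex.I * (BKW.sgn (M.bit h c) : ℂ) *
          ((if c ∈ s.filter (fun c => ¬ M.TargetsLive c ∧ ¬ M.TurnConsistent h β c) then (0 : ℝ)
            else Real.pi / 12 * (turnSign β c : ℝ) : ℝ) : ℂ)) := by
  rw [M.prod_turnFactor_eq h β s]
  by_cases H : ∀ c ∈ s, M.TargetsLive c → M.TurnConsistent h β c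
  · -- every live turn is consistent: the indicator is `1`, consistent turns carry their phase,
    -- the remaining (frozen, inconsistent) ones are cuts with `g = 0`
    have hB : ∀ c ∈ s, c ∉ s.filter (fun c => ¬ M.TargetsLive c ∧ ¬ M.TurnConsistent h β c) ↔
        M.TurnConsistent h β c := fun c hc => by
      rw [mem_filter, not_and, not_and_or, not_not, not_not]
      exact ⟨fun h' => (h' hc).elim (H c hc) id, fun h' _ => Or.inr h'⟩
    rw [if_pos H, if_pos (fun c hc hcB => perCfg_bit_eq_of_turnConsistent hunit ((hB c hc).1 hcB)), one_mul,
      prod_filter]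
    refine prod_congr rfl fun c hc => ?_
    by_cases hcons : M.TurnConsistent h β c
    · rw [if_pos hcons, if_neg ((hB c hc).2 hcons),
        perCfg_turnPhase_eq_exp M h β c (perCfg_abs_sub_eq_one_of_isTracked hunit hcons.1)]
    · rw [if_neg hcons, if_pos (mem_filter.2 ⟨hc, fun hl => hcons (H c hc hl), hcons⟩)]
      simp
  · -- an inconsistent live turn: both sides vanish
    rw [if_neg H, if_neg, zero_mul]
    intro H'
    apply H
    intro c hc hl
    rw [perCfg_turnConsistent_iff_of_targetsLive hunit β hl]
    exact H' c hc (fun hB => (mem_filter.1 hB).2.1 hl)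

end PerConfigurationFactor

/-! ### Registered sub-goal of this Part -/

/-- **Sub-goal `s13_perConfigurationFactor`** (registered on stmt-CriticalPhenomena-14132): for
every collar leg model `M`, every height configuration `h` with unit height differences across
every (vertex-cell, face-cell at it) corner, and every set of edges `ω` (meant: `ω ⊆ M.E`), the
product over the corners of the piece of the turn factors in the completed configuration
`cfgOf ω` equals the indicator that the arrow bits of `h` are `nextCorner (cfgOf ω)`-invariant
off the cut set `B = {c | ¬ TargetsLive c ∧ ¬ TurnConsistent h (cfgOf ω) c}` times
`∏_c exp(i · ε(bit h c) · g c)`, `g = (π/12) turnSign (cfgOf ω)` off `B`, `0` on `B` (D2, layer 2: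
the summand of `s12_bkwStrandExpansion`). [cite: BaxterKellandWu1976, §3–§4] -/
theorem s13_perConfigurationFactor : ∀ (M : Literature.Probability.LatticeModels.CollarLegModel) (h : ↥M.freeCells → ℤ) (ω : Finset ((ℤ × ℤ) × Bool)) [DecidablePred fun c => M.TurnConsistent h (M.cfgOf ω) c], (∀ x ∈ M.vertexCells, ∀ f ∈ Literature.Probability.LatticeModels.SixVertex.vertexFaces x, f ∈ M.faceCells → |M.hv h x - M.hf h f| = 1) → ∏ c ∈ Literature.Probability.Percolation.cornerSet M.piece, M.turnFactor h (M.cfgOf ω) c = (if ∀ c ∈ Literature.Probability.Percolation.cornerSet M.piece, c ∉ (Literature.Probability.Percolation.cornerSet M.piece).filter (fun c => ¬ M.TargetsLive c ∧ ¬ M.TurnConsistent h (M.cfgOf ω) c) → M.bit h (Literature.Probability.LatticeModels.nextCorner (M.cfgOf ω) c) = M.bit h c then (1 : ℂ) else 0) * ∏ c ∈ Literature.Probability.Percolation.cornerSet M.piece, Complex.exp (Complex.I * (Literature.Probability.Percolation.BKW.sgn (M.bit h c) : ℂ) * ((if c ∈ (Literature.Probability.Percolation.cornerSet M.piece).filter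 (fun c => ¬ M.TargetsLive c ∧ ¬ M.TurnConsistent h (M.cfgOf ω) c) then (0 : ℝ) else Real.pi / 12 * (Literature.Probability.LatticeModels.turnSign (M.cfgOf ω) c : ℝ) : ℝ) : ℂ)) :=
  fun M h ω _ hunit => perCfg_prod_turnFactor_eq h (M.cfgOf ω) (cornerSet M.piece) hunit

end Summit.CriticalPhenomena.CardyFormulaZ2.Cruxes.BoundaryDefectGaussianR.RainbowMonomialsInExcursionKernels
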